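import Summits.AnomalousDissipation.AnomalousDissipation.Theorems.BaireTransferDenseLoudDesignerForcesLine
import Literature.Analysis.FunctionSpaces.TorusSpaceTime
import Literature.Analysis.FunctionSpaces.TorusCalculusProofs
import Literature.Analysis.FunctionSpaces.TorusFourierCalculus
import Literature.Analysis.FunctionSpaces.TorusFourierModes
import Literature.Analysis.FluidPDE.LongTimeAveragePeriodic

/-!
# Stub `milestone_sweptLaminarWitness` of the line `galilean-detuning-body-force-grid`
# (crux stmt-AnomalousDissipation-1143, `BaireTransfer.DenseLoudDesignerForces`)

Milestone M1 ("SweptLaminarBase") of the line card, membership form: for a stock `S ∋ m e₁` (`m ≠ 0`) the pure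
Kolmogorov designer force (`-iF e₀` at `m e₁`, i.e. `f = F sin(2π m x₁) e₀`) lies in `sweptLoudSet S E_w ε E_V n j`
for EVERY drift `n` with `n₁ ≠ 0`, `E_V > 0`, level `j`, `ν ∈ (0, 1/(j+1))`, with the ν-UNIFORM energy
`E_w = F²/(8π²m²V₁²)` (`V₁ = (driftVel E_V n)₁`) and the quiet dissipation `ε = 2π²m²ν F²/((2π m V₁)² + (4π²m²ν)²)`.
Witness: the travelling wave `w t y = W (y + [tV])`, `W = Re (e_{m e₁} • γ e₀)`, `γ = -iF/(4π²m²ν + 2πi m V₁)`,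
pressure `0`: in the co-moving frame the swept momentum equation is the STEADY drifted Stokes balance
`(V·∇)W = νΔW + f` (shear modes have no self-advection), i.e. `(4π²m²ν + 2πi m V₁) γ = -iF`; drift periodicity is
lattice commensurability `T·V = n`; the budgets are the single-mode Parseval identities `‖W‖₂² = |γ|²/2`,
`‖∇W‖₂² = 2π²m²|γ|²`, transported by Haar invariance.  References: Frisch, *Turbulence* (1995) §5.2;
Doering–Foias, J. Fluid Mech. 467 (2002) §2; Grafakos, *Classical Fourier Analysis* (2014) §3.1.
-/

-- `Summit.<Summit>.<Problem>` is the tree's mandated summit-side namespace (CONVENTIONS §2); for this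
-- single-conjunct summit the two coincide, so the duplicate is deliberate.
set_option linter.dupNamespace false

noncomputable section

open scoped BigOperators Topology InnerProductSpace ComplexConjugate
open Filter Set Function MeasureTheory UnitAddTorus

namespace Summit.AnomalousDissipation.AnomalousDissipation.Theorems.DenseLoudDesignerForces.Galilean.SweptLaminar

open Literature.Analysis.FunctionSpaces Literature.Analysis.FunctionSpaces.Torus Literature.Analysis.FluidPDE
open Summit.AnomalousDissipation.AnomalousDissipation.Theses.BaireTransfer
open Summit.AnomalousDissipation.AnomalousDissipation.Theorems.DenseLoudDesignerForces.Negative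

/-- The flat unit torus `T³`. -/
local notation "𝕋³" => UnitAddTorus (Fin 3)
/-- Real velocity values. -/
local notation "ℝ³" => EuclideanSpace ℝ (Fin 3)
/-- Complex Fourier coefficient values. -/
local notation "ℂ³" => EuclideanSpace ℂ (Fin 3)
/-- The frequency / drift lattice `ℤ³`. -/
local notation "ℤ³" => Fin 3 → ℤ

/-- Real scalars enter the coefficients of a real trigonometric polynomial. [folklore] -/
theorem smul_realTrigPoly_apply (r : ℝ) (S : Finset ℤ³) (c : ℤ³ → ℂ³) (x : 𝕋³) :
    r • realTrigPoly S c x = realTrigPoly S (fun k => (r : ℂ) • c k) x := by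
  rw [realTrigPoly_apply, realTrigPoly_apply, ← (EuclideanSpace.realPart : ℂ³ →L[ℝ] ℝ³).map_smul,
    ← Complex.coe_smul, trigPoly_apply, trigPoly_apply, Finset.smul_sum]
  congr 1
  exact Finset.sum_congr rfl fun k _ => smul_comm _ _ _

/-- Single real modes at the same frequency add coefficientwise. [folklore] -/
theorem add_mode (k : ℤ³) (z z' : ℂ³) (x : 𝕋³) :
    realTrigPoly {k} (fun _ => z) x + realTrigPoly {k} (fun _ => z') x = realTrigPoly {k} (fun _ => z + z') x := by
  rw [realTrigPoly_singleton_apply, realTrigPoly_singleton_apply, realTrigPoly_singleton_apply, smul_add, map_add]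

/-- Coordinates of a single real mode: `(Re (e_k • z))ᵢ = Re (e_k zᵢ)`. [folklore] -/
theorem mode_apply_coord (k : ℤ³) (z : ℂ³) (x : 𝕋³) (i : Fin 3) :
    realTrigPoly {k} (fun _ => z) x i = (mFourier k x * z i).re := by
  rw [realTrigPoly_apply_coord, trigPoly_apply_coord, Finset.sum_singleton]

/-- **Derivative of a single real mode along a constant vector**: `D(Re (e_k • z))(x) V =
Re (e_k(x) • 2πi (k·V) z)`. [folklore] -/
theorem fderiv_mode (k : ℤ³) (z : ℂ³) (x : 𝕋³) (V : ℝ³) :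
    Torus.fderiv (realTrigPoly {k} (fun _ => z)) x V =
      realTrigPoly {k} (fun _ => (2 * Real.pi * Complex.I * (∑ i, (k i : ℂ) * (V i : ℂ))) • z) x := by
  rw [fderiv_apply_eq_sum_partialDeriv ((isSmooth_realTrigPoly _ _).isContDiff (by simp))]
  simp_rw [partialDeriv_realTrigPoly, smul_realTrigPoly_apply]
  rw [sum_realTrigPoly]
  refine congrFun (realTrigPoly_congr fun k' hk' => ?_) x
  rw [Finset.mem_singleton] at hk'
  subst hk'
  simp_rw [smul_smul, ← Finset.sum_smul]
  rw [Finset.mul_sum]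
  exact congrArg (· • z) (Finset.sum_congr rfl fun i _ => by ring)

/-- **No self-advection of shear modes**: a single real mode polarised along `e₀` (`z₁ = z₂ = 0`) with
frequency orthogonal to `e₀` (`k₀ = 0`) satisfies `(W·∇)W = 0`. [folklore] -/
theorem convect_mode_eq_zero {k : ℤ³} (hk : k 0 = 0) {z : ℂ³} (hz1 : z 1 = 0) (hz2 : z 2 = 0) (x : 𝕋³) :
    Torus.convect (realTrigPoly {k} (fun _ => z)) (realTrigPoly {k} (fun _ => z)) x = 0 := by
  unfold Torus.convect
  have h : (∑ i, (k i : ℂ) * ((realTrigPoly {k} (fun _ => z) x i : ℝ) : ℂ)) = 0 := by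
    rw [Fin.sum_univ_three, mode_apply_coord, mode_apply_coord, mode_apply_coord, hk, hz1, hz2]
    simp
  rw [fderiv_mode, h, mul_zero, zero_smul, realTrigPoly_singleton_apply, smul_zero, map_zero]

/-- A non-zero frequency is not its own negative. [folklore] -/
theorem ne_neg_self {k : ℤ³} (hk : k ≠ 0) : k ≠ -k := fun h => hk (funext fun i => by
  have hi := congrFun h i
  rw [Pi.neg_apply] at hi
  change k i = 0
  omega)

/-- The frequency pair `{k, -k}` is symmetric. [folklore] -/
theorem pair_symm (k : ℤ³) : ∀ k' ∈ ({k, -k} : Finset ℤ³), -k' ∈ ({k, -k} : Finset ℤ³) := fun k' hk' => by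
  simp only [Finset.mem_insert, Finset.mem_singleton] at hk' ⊢
  exact hk'.elim (fun h => Or.inr (h ▸ rfl)) fun h => Or.inl (h ▸ neg_neg _)

/-- The pair coefficients `z/2` at `k`, `z̄/2` at `-k` are conjugate symmetric. [folklore] -/
theorem isConjSymm_pair {k : ℤ³} (hk : k ≠ 0) (z : ℂ³) : IsConjSymm (fun k' : ℤ³ =>
      if k' = k then (2⁻¹ : ℂ) • z else if k' = -k then (2⁻¹ : ℂ) • EuclideanSpace.conjVec z else 0) := by
  have hkk : k ≠ -k := ne_neg_self hk
  intro k'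
  by_cases h1 : k' = k
  · subst h1; simp only [if_true, if_neg hkk.symm]; rw [EuclideanSpace.conjVec_smul, map_inv₀, map_ofNat]
  by_cases h2 : k' = -k
  · subst h2; simp only [neg_neg, if_true, if_neg hkk.symm]
    rw [EuclideanSpace.conjVec_smul, EuclideanSpace.conjVec_conjVec, map_inv₀, map_ofNat]
  · have h2' : -k' ≠ -k := fun h => h1 (neg_injective h)
    simp only [if_neg h1, if_neg h2, if_neg (fun h => h2 (by rw [← h, neg_neg]) : -k' ≠ k), if_neg h2',
      EuclideanSpace.conjVec_zero]

/-- **A single real mode is a real trigonometric polynomial on the symmetric pair `{k, -k}`** with the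
conjugate-symmetric coefficients `z/2`, `z̄/2` (`Re w = (w + w̄)/2`). [folklore] -/
theorem mode_eq_pair {k : ℤ³} (hk : k ≠ 0) (z : ℂ³) : realTrigPoly {k} (fun _ => z) = realTrigPoly {k, -k}
      (fun k' : ℤ³ => if k' = k then (2⁻¹ : ℂ) • z else if k' = -k then (2⁻¹ : ℂ) • EuclideanSpace.conjVec z
        else 0) := by
  have hkk : k ≠ -k := ne_neg_self hk
  funext x
  rw [realTrigPoly_singleton_apply, realTrigPoly_apply, trigPoly_apply, Finset.sum_pair hkk]
  simp only [if_true, if_neg hkk.symm]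
  have hconj : mFourier (-k) x • ((2⁻¹ : ℂ) • EuclideanSpace.conjVec z) =
      EuclideanSpace.conjVec (mFourier k x • ((2⁻¹ : ℂ) • z)) := by
    rw [EuclideanSpace.conjVec_smul, EuclideanSpace.conjVec_smul, mFourier_neg, map_inv₀, map_ofNat]
  rw [hconj, map_add, EuclideanSpace.realPart_conjVec, ← two_smul ℝ,
    ← (EuclideanSpace.realPart : ℂ³ →L[ℝ] ℝ³).map_smul, ← Complex.coe_smul, Complex.ofReal_ofNat,
    smul_comm (2 : ℂ) (mFourier k x), smul_smul, smul_smul, mul_assoc,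
    mul_inv_cancel₀ (two_ne_zero : (2 : ℂ) ≠ 0), mul_one]

/-- **Energy of a single real mode**: `∫ ‖Re (e_k • z)‖² = ‖z‖²/2` (`k ≠ 0`). [folklore] -/
theorem integral_norm_sq_mode {k : ℤ³} (hk : k ≠ 0) (z : ℂ³) :
    ∫ x, ‖realTrigPoly {k} (fun _ => z) x‖ ^ 2 = ‖z‖ ^ 2 / 2 := by
  rw [mode_eq_pair hk, integral_norm_sq_realTrigPoly (pair_symm k) (isConjSymm_pair hk z),
    Finset.sum_pair (ne_neg_self hk)]
  simp only [if_true, if_neg (ne_neg_self hk).symm]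
  rw [norm_smul, norm_smul, EuclideanSpace.norm_conjVec, norm_inv, Complex.norm_ofNat]
  ring

/-- **Spectral gradient norm of a single real mode**: `‖∇ Re (e_k • z)‖₂² = 2π²|k|²‖z‖²` (`k ≠ 0`). [folklore] -/
theorem eGradNormSq_mode {k : ℤ³} (hk : k ≠ 0) (z : ℂ³) :
    eGradNormSq (realTrigPoly {k} (fun _ => z)) = ENNReal.ofReal (2 * Real.pi ^ 2 * freqNormSq k * ‖z‖ ^ 2) := by
  rw [mode_eq_pair hk, eGradNormSq_realTrigPoly (pair_symm k) (isConjSymm_pair hk z),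
    Finset.sum_pair (ne_neg_self hk)]
  congr 1
  simp only [if_true, if_neg (ne_neg_self hk).symm]
  rw [norm_smul, norm_smul, EuclideanSpace.norm_conjVec, norm_inv, Complex.norm_ofNat, freqNormSq_neg]
  ring

/-- A single real mode with non-zero frequency is momentum free: `∫ Re (e_k • z) = 0`. [folklore] -/
theorem hasZeroMean_mode {k : ℤ³} (hk : k ≠ 0) (z : ℂ³) : HasZeroMean (realTrigPoly {k} (fun _ => z)) := by
  have h1 : (fun x => realTrigPoly {k} (fun _ => z) x) = fun x => EuclideanSpace.realPart (mFourier k x • z) :=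
    funext fun x => realTrigPoly_singleton_apply k _ x
  have hint : Integrable (fun x : 𝕋³ => mFourier k x • z) volume :=
    ((mFourier k).continuous.smul continuous_const).integrable_unitAddTorus
  unfold HasZeroMean
  rw [h1, ContinuousLinearMap.integral_comp_comm _ hint, integral_smul_const, integral_mFourier, if_neg hk, zero_smul, map_zero]

/-- Re-centred lifts of a translate. [folklore] -/
theorem liftAt_comp_add_right {F : Type*} (f : 𝕋³ → F) (a y : 𝕋³) : liftAt (fun z => f (z + a)) y = liftAt f (y + a) :=
  funext fun v => by simp only [liftAt_apply, add_right_comm _ _ a]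

/-- Fréchet derivatives commute with translations (translates `y ↦ W (y + a)` of the profile). [folklore] -/
theorem fderiv_comp_add_right {F : Type*} [NormedAddCommGroup F] [NormedSpace ℝ F] (f : 𝕋³ → F) (a y : 𝕋³) :
    Torus.fderiv (fun z => f (z + a)) y = Torus.fderiv f (y + a) := by
  unfold Torus.fderiv
  rw [liftAt_comp_add_right]

/-- Laplacians commute with translations. [folklore] -/
theorem laplacian_comp_add_right {F : Type*} [NormedAddCommGroup F] [NormedSpace ℝ F] (f : 𝕋³ → F) (a y : 𝕋³) :
    Torus.laplacian (fun z => f (z + a)) y = Torus.laplacian f (y + a) := by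
  unfold Torus.laplacian
  rw [liftAt_comp_add_right]

/-- Partial derivatives commute with translations. [folklore] -/
theorem partialDeriv_comp_add_right {F : Type*} [NormedAddCommGroup F] [NormedSpace ℝ F] (f : 𝕋³ → F) (i : Fin 3)
    (a y : 𝕋³) : partialDeriv i (fun z => f (z + a)) y = partialDeriv i f (y + a) := by
  simp only [Torus.partialDeriv, Torus.lineDeriv, add_right_comm _ _ a]

/-- Divergences commute with translations. [folklore] -/
theorem divergence_comp_add_right (W : 𝕋³ → ℝ³) (a y : 𝕋³) :
    divergence (fun z => W (z + a)) y = divergence W (y + a) := by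
  simp only [Torus.divergence]
  exact Finset.sum_congr rfl fun i _ => partialDeriv_comp_add_right (fun z => W z i) i a y

/-- The spectral gradient norm of a translate of a smooth field. [folklore] -/
theorem eGradNormSq_comp_add_right {W : 𝕋³ → ℝ³} (hW : IsSmooth W) (a : 𝕋³) :
    eGradNormSq (fun y => W (y + a)) = eGradNormSq W := by
  rw [eGradNormSq_eq_ofReal_gradNormSq (hW.comp_add_right a), eGradNormSq_eq_ofReal_gradNormSq hW]
  congr 1
  unfold gradNormSq
  simp_rw [partialDeriv_comp_add_right]
  exact integral_add_right_eq_self (μ := (volume : Measure 𝕋³)) (fun z => ∑ i, ‖partialDeriv i W z‖ ^ 2) a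

/-- **Joint smoothness of a travelling wave** of a smooth profile. [folklore] -/
theorem isSmoothSpaceTimeOn_travelling {W : 𝕋³ → ℝ³} (hW : IsSmooth W) (V : ℝ³) (S' : Set ℝ) :
    Torus.IsSmoothSpaceTimeOn S' (fun (s : ℝ) (y : 𝕋³) => W (y + proj (s • V))) := by
  have h : stLift (fun (s : ℝ) (y : 𝕋³) => W (y + proj (s • V))) = lift W ∘ fun z : ℝ × ℝ³ => z.2 + z.1 • V := by
    funext z
    simp [stLift, lift, proj_add]
  unfold Torus.IsSmoothSpaceTimeOn
  rw [h]
  exact (hW.comp (contDiff_snd.add (contDiff_fst.smul contDiff_const))).contDiffOn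

/-- **A travelling wave of a steady drifted balance solves the swept problem classically** (pressure `0`):
if `DW·V + (W·∇)W = νΔW + f` and `div W = 0` then `w t y = W (y + [tV])` solves
`∂ₜw + (w·∇)w = νΔw - ∇0 + f(· + [tV])` (as `∂ₜ W(y + [tV]) = DW(y + [tV]) V`), `div w = 0`, jointly smoothly
on `ℝ × T³`. [folklore] -/
theorem isClassical_travelling {W f : 𝕋³ → ℝ³} (hW : IsSmooth W) (hdiv : IsDivFree W) {V : ℝ³} {ν : ℝ}
    (hbal : ∀ x, Torus.fderiv W x V + Torus.convect W W x = ν • Torus.laplacian W x + f x) :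
    IsClassicalNSSolutionOn univ ν (sweptForce V f) (fun (s : ℝ) (y : 𝕋³) => W (y + proj (s • V)))
      (fun (_ : ℝ) (_ : 𝕋³) => (0 : ℝ)) where
  smooth_velocity := isSmoothSpaceTimeOn_travelling hW V univ
  smooth_pressure := isSmoothSpaceTimeOn_const (isSmooth_const (0 : ℝ)) univ
  momentum := fun t _ y => by
    have hC : IsContDiff 1 W := hW.isContDiff (by simp)
    have hg : Torus.gradient (fun _ : 𝕋³ => (0 : ℝ)) y = 0 := by
      rw [Torus.gradient, (rfl : liftAt (fun _ : 𝕋³ => (0 : ℝ)) y = fun _ => 0)]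
      exact gradient_fun_const 0 0
    have hd : Torus.timeDerivWithin univ (fun (s : ℝ) (y : 𝕋³) => W (y + proj (s • V))) t y =
        Torus.fderiv W (y + proj (t • V)) V := by
      rw [Torus.timeDerivWithin, derivWithin_univ]
      show deriv (fun τ : ℝ => W (y + proj (τ • V))) t = _
      rw [(hasDerivAt_comp_add_proj_smul hC y V t).deriv, lineDeriv_eq_fderiv_apply hC]
    show _ + Torus.convect (fun z => W (z + proj (t • V))) (fun z => W (z + proj (t • V))) y =
      ν • Torus.laplacian (fun z => W (z + proj (t • V))) y - _ + f (y + proj (t • V))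
    rw [hd, Torus.convect, fderiv_comp_add_right, laplacian_comp_add_right, hg, sub_zero]
    exact hbal _
  divFree := fun t _ y => by
    show divergence (fun z => W (z + proj (t • V))) y = 0
    rw [divergence_comp_add_right]
    exact hdiv _

/-- **Drift periodicity**: for a lattice-commensurate drift `T • V = n ∈ ℤ³` the travelling wave is
`T`-periodic in time. [folklore] -/
theorem periodic_travelling (W : 𝕋³ → ℝ³) {V : ℝ³} {T : ℝ} {n : ℤ³} (hTV : T • V = latticeVec n) :
    Function.Periodic (fun (s : ℝ) (y : 𝕋³) => W (y + proj (s • V))) T := fun s => funext fun y =>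
  show W (y + proj ((s + T) • V)) = W (y + proj (s • V)) by rw [add_smul, proj_add, hTV, proj_latticeVec, add_zero]

/-- **Mean energy of a travelling wave**: every slice has the energy of the profile (Haar invariance), and the
long-time average of a constant is the constant. [folklore] -/
theorem meanEnergy_travelling (W : 𝕋³ → ℝ³) (V : ℝ³) :
    meanEnergy (fun (s : ℝ) (y : 𝕋³) => W (y + proj (s • V))) = ∫ x, ‖W x‖ ^ 2 := by
  have h : (fun t => ∫ y, ‖(fun (s : ℝ) (y : 𝕋³) => W (y + proj (s • V))) t y‖ ^ 2) = fun _ => ∫ x, ‖W x‖ ^ 2 :=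
    funext fun t => integral_add_right_eq_self (μ := (volume : Measure 𝕋³)) (fun x => ‖W x‖ ^ 2) _
  have hper : Function.Periodic (fun _ : ℝ => ∫ x, ‖W x‖ ^ 2) 1 := fun _ => rfl
  rw [meanEnergy_eq_longTimeAvgSup, h, longTimeAvgSup_eq_of_periodic hper one_pos, intervalIntegral.integral_const]
  simp

/-- **Mean dissipation of a travelling wave** of a smooth profile: every slice has the gradient norm of the
profile. [folklore] -/
theorem meanDissipation_travelling {W : 𝕋³ → ℝ³} (hW : IsSmooth W) (ν : ℝ) (V : ℝ³) :
    meanDissipation ν (fun (s : ℝ) (y : 𝕋³) => W (y + proj (s • V))) = ν * (eGradNormSq W).toReal := by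
  have h : (fun t => ν * (eGradNormSq ((fun (s : ℝ) (y : 𝕋³) => W (y + proj (s • V))) t)).toReal) =
      fun _ => ν * (eGradNormSq W).toReal := by
    funext t
    simp only
    rw [eGradNormSq_comp_add_right hW]
  have hper : Function.Periodic (fun _ : ℝ => ν * (eGradNormSq W).toReal) 1 := fun _ => rfl
  unfold meanDissipation
  rw [h, longTimeAvgSup_eq_of_periodic hper one_pos, intervalIntegral.integral_const]
  simp

/-- `m e₁ ≠ 0` for `m ≠ 0`. [folklore] -/
theorem single_ne_zero {m : ℤ} (hm : m ≠ 0) : (Pi.single 1 m : ℤ³) ≠ 0 := fun h => hm (by simpa using congrFun h 1)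

/-- `|m e₁|² = m²`. [folklore] -/
theorem freqNormSq_single (m : ℤ) : freqNormSq (Pi.single 1 m : ℤ³) = (m : ℝ) ^ 2 := by
  simp [freqNormSq, Pi.single_apply]

/-- `(m e₁) · V = m V₁`. [folklore] -/
theorem sum_single_mul (m : ℤ) (V : ℝ³) : ∑ i, ((Pi.single 1 m : ℤ³) i : ℂ) * (V i : ℂ) = (m : ℂ) * (V 1 : ℂ) := by
  simp [Pi.single_apply]

/-- `c • (a eᵢ) = (c a) eᵢ` on `ℂ³`. [folklore] -/
theorem smul_single (c a : ℂ) (i : Fin 3) : c • (EuclideanSpace.single i a : ℂ³) = EuclideanSpace.single i (c * a) := by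
  ext j
  by_cases h : j = i <;> simp [h]

/-- `(a + b) eᵢ = a eᵢ + b eᵢ` on `ℂ³`. [folklore] -/
theorem single_add (a b : ℂ) (i : Fin 3) :
    (EuclideanSpace.single i (a + b) : ℂ³) = EuclideanSpace.single i a + EuclideanSpace.single i b :=
  PiLp.single_add 2 i

/-- **The Leray-projected coefficients of the pure Kolmogorov designer force**: `-iF e₀` at `m e₁`
(transversal, so fixed by the Leray multiplier), `0` elsewhere. [folklore] -/
theorem lerayCoeff_kolmogorov {S : Finset ℤ³} {m : ℤ} (hmS : Pi.single 1 m ∈ S) (hm : m ≠ 0) (F : ℝ) (k : ℤ³) :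
    Torus.lerayCoeff k (coeffExt S (fun k : ↥S => if (k : ℤ³) = Pi.single 1 m then
      EuclideanSpace.single (0 : Fin 3) (-(Complex.I * (F : ℂ))) else 0) k) =
      if k = Pi.single 1 m then EuclideanSpace.single (0 : Fin 3) (-(Complex.I * (F : ℂ))) else 0 := by
  by_cases hk : k = Pi.single 1 m
  · rw [if_pos hk, coeffExt_of_mem _ (hk ▸ hmS)]
    simp only [hk, if_true]
    rw [Torus.lerayCoeff, if_neg (single_ne_zero hm)]
    simp [Pi.single_apply]
  · rw [if_neg hk]
    have hz : coeffExt S (fun k : ↥S => if (k : ℤ³) = Pi.single 1 m then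
        EuclideanSpace.single (0 : Fin 3) (-(Complex.I * (F : ℂ))) else 0) k = 0 := by
      by_cases hkS : k ∈ S
      · rw [coeffExt_of_mem _ hkS]
        exact if_neg hk
      · exact coeffExt_of_not_mem _ hkS
    rw [hz]
    by_cases hk0 : k = 0 <;> simp [Torus.lerayCoeff, hk0]

/-- **The pure Kolmogorov designer force is a single real mode**: `f = Re (e_{m e₁} • (-iF) e₀) =
F sin(2π m x₁) e₀`. [folklore] -/
theorem force_kolmogorov {S : Finset ℤ³} {m : ℤ} (hmS : Pi.single 1 m ∈ S) (hm : m ≠ 0) (F : ℝ) :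
    force S (fun k : ↥S => if (k : ℤ³) = Pi.single 1 m then
      EuclideanSpace.single (0 : Fin 3) (-(Complex.I * (F : ℂ))) else 0) =
      realTrigPoly {Pi.single 1 m} (fun _ => EuclideanSpace.single (0 : Fin 3) (-(Complex.I * (F : ℂ)))) := by
  funext x
  rw [force, realTrigPoly_apply, realTrigPoly_apply, trigPoly_apply, trigPoly_apply, Finset.sum_singleton,
    Finset.sum_eq_single_of_mem (Pi.single 1 m) hmS (fun k _ hk => by
      rw [lerayCoeff_kolmogorov hmS hm F k, if_neg hk, smul_zero]),
    lerayCoeff_kolmogorov hmS hm F, if_pos rfl]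

/-- **SWEPT LAMINAR WITNESS** (milestone M1 of the line card, membership form): for a stock `S ∋ m e₁` (`m ≠ 0`)
the pure Kolmogorov designer force of amplitude `F` (`-iF e₀` at `m e₁`, i.e. `f = F sin(2π m x₁) e₀`) belongs
to the swept loud set of EVERY drift `n` with `n₁ ≠ 0`, `E_V > 0`, at every level `j` and every `ν ∈ (0, 1/(j+1))`,
with the ν-UNIFORM energy budget `F²/(8π²m²V₁²)` (`V₁ = (driftVel E_V n) 1`) and the QUIET dissipation
`2π²m²ν F²/((2π m V₁)² + (4π²m²ν)²)`; witness: the travelling wave `w t y = Re (e_{m e₁}(y + [tV]) γ) e₀`,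
`γ = -iF/(4π²m²ν + 2πi m V₁)`, pressure `0`. [folklore] -/
theorem milestone_sweptLaminarWitness : ∀ (S : Finset ℤ³) (m : ℤ) (F EV ν : ℝ) (n : ℤ³) (j : ℕ) (hm : Pi.single 1 m ∈ S), m ≠ 0 → 0 < EV → n ≠ 0 → n 1 ≠ 0 → 0 < ν → ν < 1 / ((j : ℝ) + 1) → (fun k : ↥S => if (k : ℤ³) = Pi.single 1 m then EuclideanSpace.single (0 : Fin 3) (-(Complex.I * (F : ℂ))) else 0) ∈ sweptLoudSet S (F ^ 2 / (8 * Real.pi ^ 2 * (m : ℝ) ^ 2 * (driftVel EV n 1) ^ 2)) (2 * Real.pi ^ 2 * (m : ℝ) ^ 2 * ν * (F ^ 2 / ((2 * Real.pi * m * driftVel EV n 1) ^ 2 + (4 * Real.pi ^ 2 * (m : ℝ) ^ 2 * ν) ^ 2))) EV n j := by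
  intro S m F EV ν n j hmS hm hEV hn hn1 hν hνj
  -- the drift and the rates `σ = 2π m V₁`, `L = 4π²m²ν`
  set V : ℝ³ := driftVel EV n with hV_def
  have hV1ne : V 1 ≠ 0 := by
    rw [show V 1 = Real.sqrt EV / ‖latticeVec n‖ * (n 1 : ℝ) by simp [hV_def, driftVel, latticeVec_apply]]
    exact mul_ne_zero (div_ne_zero (Real.sqrt_pos.2 hEV).ne' (norm_latticeVec_pos hn).ne') (Int.cast_ne_zero.2 hn1)
  have hmR : (m : ℝ) ≠ 0 := Int.cast_ne_zero.2 hm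
  set σ : ℝ := 2 * Real.pi * (m : ℝ) * V 1 with hσ_def
  set L : ℝ := 4 * Real.pi ^ 2 * (m : ℝ) ^ 2 * ν with hL_def
  have hL : 0 < L := by positivity
  -- the complex amplitude `γ = -iF / (L + iσ)` and the scalar balance `2πi m V₁ γ = ν (-4π²m²) γ - iF`
  set den : ℂ := (L : ℂ) + (σ : ℂ) * Complex.I with hden_def
  have hden_re : den.re = L := by simp [hden_def]
  have hden_im : den.im = σ := by simp [hden_def]
  have hden : den ≠ 0 := fun h => hL.ne' (by rw [← hden_re, h, Complex.zero_re])
  have hden_sq : ‖den‖ ^ 2 = σ ^ 2 + L ^ 2 := by rw [Complex.sq_norm, Complex.normSq_apply, hden_re, hden_im]; ring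
  set γ : ℂ := -(Complex.I * (F : ℂ)) / den with hγ_def
  have hγden : γ * den = -(Complex.I * (F : ℂ)) := div_mul_cancel₀ _ hden
  have hγ_sq : ‖γ‖ ^ 2 = F ^ 2 / (σ ^ 2 + L ^ 2) := by
    rw [hγ_def, norm_div, div_pow, hden_sq, norm_neg, norm_mul, Complex.norm_I, one_mul, Complex.norm_real,
      Real.norm_eq_abs, sq_abs]
  have hsc : (2 * Real.pi * Complex.I * ((m : ℂ) * ((V 1 : ℝ) : ℂ))) * γ =
      (((ν * -(4 * Real.pi ^ 2 * (m : ℝ) ^ 2) : ℝ) : ℂ)) * γ + -(Complex.I * (F : ℂ)) := by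
    rw [hden_def, hL_def, hσ_def] at hγden
    push_cast at hγden ⊢
    linear_combination hγden
  -- the polarisation `γ e₀` and the profile `W = Re (e_{m e₁} • γ e₀)`
  set z : ℂ³ := EuclideanSpace.single (0 : Fin 3) γ with hz_def
  have hz1 : z 1 = 0 := by simp [hz_def]
  have hz2 : z 2 = 0 := by simp [hz_def]
  have hz_norm : ‖z‖ = ‖γ‖ := by simp [hz_def]
  have hk0 : (Pi.single 1 m : ℤ³) ≠ 0 := single_ne_zero hm
  have hk00 : (Pi.single 1 m : ℤ³) 0 = 0 := by simp
  set W : 𝕋³ → ℝ³ := realTrigPoly {Pi.single 1 m} (fun _ => z) with hW_def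
  have hWs : IsSmooth W := isSmooth_realTrigPoly _ _
  have hWdiv : IsDivFree W := isDivFree_realTrigPoly_singleton (by simp [Fin.sum_univ_three, hz1, hz2])
  -- the steady drifted balance `DW·V + (W·∇)W = νΔW + f`
  have hbal : ∀ x, Torus.fderiv W x V + Torus.convect W W x = ν • Torus.laplacian W x +
      realTrigPoly {Pi.single 1 m} (fun _ => EuclideanSpace.single (0 : Fin 3) (-(Complex.I * (F : ℂ)))) x := by
    intro x
    rw [hW_def, fderiv_mode, sum_single_mul, convect_mode_eq_zero hk00 hz1 hz2, add_zero,
      laplacian_realTrigPoly_singleton, freqNormSq_single, smul_smul, smul_realTrigPoly_apply, add_mode, hz_def,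
      smul_single, smul_single, hsc, single_add]
  -- the travelling wave: classical swept solution, drift-periodic, momentum free, with the stated budgets
  have hsol : IsClassicalNSSolutionOn univ ν (sweptForce V (force S (fun k : ↥S =>
      if (k : ℤ³) = Pi.single 1 m then EuclideanSpace.single (0 : Fin 3) (-(Complex.I * (F : ℂ))) else 0)))
      (fun (s : ℝ) (y : 𝕋³) => W (y + proj (s • V))) (fun (_ : ℝ) (_ : 𝕋³) => (0 : ℝ)) := by
    rw [force_kolmogorov hmS hm F]
    exact isClassical_travelling hWs hWdiv hbal
  have hmean : ∀ t, HasZeroMean ((fun (s : ℝ) (y : 𝕋³) => W (y + proj (s • V))) t) := fun t => by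
    show ∫ y, W (y + proj (t • V)) = 0
    rw [integral_add_right_eq_self (μ := (volume : Measure 𝕋³)) W]
    exact hasZeroMean_mode hk0 z
  have hE : meanEnergy (fun (s : ℝ) (y : 𝕋³) => W (y + proj (s • V))) ≤ F ^ 2 / (8 * Real.pi ^ 2 * (m : ℝ) ^ 2 * V 1 ^ 2) := by
    rw [meanEnergy_travelling, hW_def, integral_norm_sq_mode hk0, hz_norm, hγ_sq, div_div]
    refine div_le_div_of_nonneg_left (sq_nonneg F) (by positivity) ?_
    rw [hσ_def]
    nlinarith [sq_nonneg L]
  have hD : meanDissipation ν (fun (s : ℝ) (y : 𝕋³) => W (y + proj (s • V))) =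
      2 * Real.pi ^ 2 * (m : ℝ) ^ 2 * ν * (F ^ 2 / (σ ^ 2 + L ^ 2)) := by
    rw [meanDissipation_travelling hWs, hW_def, eGradNormSq_mode hk0, freqNormSq_single,
      ENNReal.toReal_ofReal (by positivity), hz_norm, hγ_sq]
    ring
  exact ⟨ν, hν, hνj, _, _, hsol, periodic_travelling W (driftPeriod_smul_driftVel hEV hn), hmean, hE, hD.ge⟩

end Summit.AnomalousDissipation.AnomalousDissipation.Theorems.DenseLoudDesignerForces.Galilean.SweptLaminar

end
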